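import Literature.MathematicalPhysics.QuantumLattice.FermionQuasiFree
import Literature.MathematicalPhysics.QuantumLattice.SpinSectorPartitionFnTransfer
import Literature.MathematicalPhysics.QuantumLattice.LatticeToriProofs
import Literature.MathematicalPhysics.QuantumLattice.HubbardNNNHoppingFlux
import HarnessLib

/-!
# Free-gas (`U = 0`) current clustering for TcThermcert1's Hypothesis C — part 1: one-body decay of `e^{-βh}`

Helper file for route `TcThermcert1` (crux K1′ `ThermalStiffnessCeilingU8b8_le_7o44`, item `stmt-Ventures-24560`; line
`Cruxes/ThermalStiffnessCeilingU8b8_le_7o44/Lines/gauge_qbp_far_seam.lean` v1.4, Hypothesis C = `CurrentClustering U n β ξ`).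
This part supplies the ONE-BODY inputs of the `U = 0` rung (`∃ ξ, CurrentClustering 0 n β ξ` in the non-degenerate regime):

* §1 (generic, any finite index type): for a matrix `K` whose rows have absolute sums `≤ m` and whose non-zero entries join points
  at `D`-distance `≤ 1` of an `ℕ`-valued pseudo-metric `D`, `Σ_k ‖(K^n)_{qk}‖ ≤ m^n`, `(K^n)_{qk} = 0` for `n < D(q,k)`, and the
  **heat-kernel type bound** `‖(e^{K})_{qk}‖ ≤ m^d/d! · e^m` for every `d ≤ D(q,k)` (exponential series, term by term);
* §2 (the free torus): for the one-body matrix `h₀ = hubbardOneBody (fermionTorusGraph 2 L) 1 0` (nearest-neighbour hopping `t = 1`,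
  both spins) — `hubbardTorusTT'Flux L 0 0 0 = dΓ(h₀)`; the rows of `h₀` have absolute sum `≤ 4`; `e^{c h₀}` is spin-block-diagonal and
  symmetric; `‖(e^{c h₀})_{(x,σ),(y,τ)}‖ ≤ (4‖c‖)^d/d! · e^{4‖c‖}` for `d ≤ dist_∞(x,y)` (torus distance); and the commutator bound
  `‖[dΓ(h₀), c†_{xσ}]‖ ≤ 4` consumed by the tree's sector transfer lemma (`SpinSectorPartitionFnTransfer`).

HONEST FRAMING: finite-dimensional folklore about the FREE (`U = 0`) torus gas; nothing here touches `U = 8`, the bet C8, or `T_c`;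
superconductivity in the Hubbard model is NOT proved (or disproved) by any of this.
-/

noncomputable section

namespace Summit.Ventures.CertifiedManyBodySolver.Theorems.TcThermcert1.FreeGasCurrentClustering

open NormedSpace Matrix Finset
open Literature.MathematicalPhysics.QuantumLattice
open Literature.Probability.LatticeModels (TorusSite torusGraph)
open scoped Matrix.Norms.L2Operator ComplexOrder

/-! ## §1 Walk counting: row sums, support and the exponential series of a short-range matrix -/

section Generic

variable {ι : Type*} [Fintype ι] [DecidableEq ι]

/-- **Row sums of powers**: if every row of `K` has absolute sum `≤ m` (`m ≥ 0`) then every row of `K^n` has absolute sum `≤ m^n`. -/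
theorem sum_norm_pow_apply_le (K : Matrix ι ι ℂ) {m : ℝ} (hm0 : 0 ≤ m) (hm : ∀ q, ∑ k, ‖K q k‖ ≤ m) :
    ∀ (n : ℕ) (q : ι), ∑ k, ‖(K ^ n) q k‖ ≤ m ^ n := by
  intro n
  induction n with
  | zero =>
    intro q
    rw [pow_zero, pow_zero]
    have h : ∑ k, ‖(1 : Matrix ι ι ℂ) q k‖ = 1 := by
      rw [Finset.sum_eq_single q]
      · rw [Matrix.one_apply_eq, norm_one]
      · intro k _ hk
        rw [Matrix.one_apply_ne (Ne.symm hk), norm_zero]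
      · intro h; exact absurd (Finset.mem_univ q) h
    rw [h]
  | succ n ih =>
    intro q
    rw [pow_succ]
    calc ∑ k, ‖(K ^ n * K) q k‖ = ∑ k, ‖∑ l, (K ^ n) q l * K l k‖ := by simp only [Matrix.mul_apply]
      _ ≤ ∑ k, ∑ l, ‖(K ^ n) q l‖ * ‖K l k‖ :=
          Finset.sum_le_sum fun k _ => (norm_sum_le _ _).trans (le_of_eq (by simp only [norm_mul]))
      _ = ∑ l, ‖(K ^ n) q l‖ * ∑ k, ‖K l k‖ := by rw [Finset.sum_comm]; simp only [Finset.mul_sum]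
      _ ≤ ∑ l, ‖(K ^ n) q l‖ * m := Finset.sum_le_sum fun l _ => mul_le_mul_of_nonneg_left (hm l) (norm_nonneg _)
      _ = (∑ l, ‖(K ^ n) q l‖) * m := by rw [Finset.sum_mul]
      _ ≤ m ^ n * m := mul_le_mul_of_nonneg_right (ih q) hm0
      _ = m ^ (n + 1) := by rw [pow_succ]

/-- A single entry of `K^n` is bounded by `m^n` (row-sum bound). -/
theorem norm_pow_apply_le (K : Matrix ι ι ℂ) {m : ℝ} (hm0 : 0 ≤ m) (hm : ∀ q, ∑ k, ‖K q k‖ ≤ m) (n : ℕ) (q k : ι) :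
    ‖(K ^ n) q k‖ ≤ m ^ n :=
  (Finset.single_le_sum (fun k' _ => norm_nonneg ((K ^ n) q k')) (Finset.mem_univ k)).trans (sum_norm_pow_apply_le K hm0 hm n q)

/-- **Support of powers**: if the non-zero entries of `K` join points at `D`-distance `≤ 1` (`D` an `ℕ`-valued pseudo-metric), then
`(K^n)_{qk} = 0` whenever `n < D(q,k)` (a walk of `n` steps moves `D` by at most `n`). -/
theorem pow_apply_eq_zero_of_lt (K : Matrix ι ι ℂ) (D : ι → ι → ℕ) (hD0 : ∀ q, D q q = 0)
    (hDt : ∀ q l k, D q k ≤ D q l + D l k) (hK : ∀ l k, K l k ≠ 0 → D l k ≤ 1) :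
    ∀ (n : ℕ) (q k : ι), n < D q k → (K ^ n) q k = 0 := by
  intro n
  induction n with
  | zero =>
    intro q k hqk
    rw [pow_zero]
    by_cases h : q = k
    · subst h; rw [hD0] at hqk; exact absurd hqk (lt_irrefl 0)
    · exact Matrix.one_apply_ne h
  | succ n ih =>
    intro q k hqk
    rw [pow_succ, Matrix.mul_apply]
    refine Finset.sum_eq_zero fun l _ => ?_
    by_cases hl : K l k = 0
    · rw [hl, mul_zero]
    · have h1 := hK l k hl
      have h2 := hDt q l k
      rw [ih q l (by omega), zero_mul]

/-- **Heat-kernel type bound for a short-range matrix.** Under the hypotheses of `sum_norm_pow_apply_le` and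
`pow_apply_eq_zero_of_lt`: `‖(e^{K})_{qk}‖ ≤ m^d/d! · e^m` for every `d ≤ D(q,k)` (the terms of order `< d` of the exponential series
vanish at `(q,k)`, the others are bounded by `m^n/n! ≤ (m^d/d!)·m^{n-d}/(n-d)!`). -/
theorem norm_exp_apply_le (K : Matrix ι ι ℂ) (D : ι → ι → ℕ) (hD0 : ∀ q, D q q = 0)
    (hDt : ∀ q l k, D q k ≤ D q l + D l k) (hK : ∀ l k, K l k ≠ 0 → D l k ≤ 1) {m : ℝ} (hm0 : 0 ≤ m)
    (hm : ∀ q, ∑ k, ‖K q k‖ ≤ m) (q k : ι) {d : ℕ} (hd : d ≤ D q k) :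
    ‖(exp K) q k‖ ≤ m ^ d / d.factorial * Real.exp m := by
  -- the exponential series, evaluated at the entry `(q,k)`
  have hf : HasSum (fun n : ℕ => (((n.factorial : ℂ)⁻¹) • K ^ n) q k) ((exp K) q k) :=
    Pi.hasSum.1 (Pi.hasSum.1 (exp_series_hasSum_exp' (𝕂 := ℂ) K) q) k
  -- the dominating real series `g n = [d ≤ n] (m^d/d!) m^{n-d}/(n-d)!`, with sum `(m^d/d!) e^m`
  set c : ℝ := m ^ d / d.factorial with hc
  set g : ℕ → ℝ := fun n => if d ≤ n then c * (m ^ (n - d) / (n - d).factorial) else 0 with hg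
  have hexp : HasSum (fun j : ℕ => m ^ j / j.factorial) (Real.exp m) := by
    rw [Real.exp_eq_exp_ℝ]
    exact expSeries_div_hasSum_exp m
  have hg_shift : (fun n => g (n + d)) = fun j => c * (m ^ j / j.factorial) := by
    funext j
    simp only [hg, le_add_iff_nonneg_left, zero_le, if_true, Nat.add_sub_cancel]
  have hg_init : ∑ i ∈ Finset.range d, g i = 0 :=
    Finset.sum_eq_zero fun i hi => by rw [hg]; simp only; rw [if_neg (not_le.2 (Finset.mem_range.1 hi))]
  have hgsum : HasSum g (c * Real.exp m) := by
    have h1 : HasSum (fun n => g (n + d)) (c * Real.exp m - ∑ i ∈ Finset.range d, g i) := by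
      rw [hg_shift, hg_init, sub_zero]
      exact hexp.mul_left c
    exact (hasSum_nat_add_iff' d).1 h1
  -- termwise domination
  have hle : ∀ n, ‖(((n.factorial : ℂ)⁻¹) • K ^ n) q k‖ ≤ g n := by
    intro n
    rw [Matrix.smul_apply, norm_smul, norm_inv, Complex.norm_natCast, hg]
    simp only
    by_cases hn : d ≤ n
    · rw [if_pos hn]
      have hKn : ‖(K ^ n) q k‖ ≤ m ^ n := norm_pow_apply_le K hm0 hm n q k
      have hfac : ((d.factorial : ℝ) * ((n - d).factorial : ℝ)) ≤ (n.factorial : ℝ) := by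
        have h := Nat.le_of_dvd (Nat.factorial_pos _) (Nat.factorial_mul_factorial_dvd_factorial_add d (n - d))
        rw [Nat.add_sub_cancel' hn] at h
        exact_mod_cast h
      have hdpos : (0 : ℝ) < d.factorial := by exact_mod_cast Nat.factorial_pos d
      have hndpos : (0 : ℝ) < (n - d).factorial := by exact_mod_cast Nat.factorial_pos (n - d)
      have hnpos : (0 : ℝ) < n.factorial := by exact_mod_cast Nat.factorial_pos n
      calc (n.factorial : ℝ)⁻¹ * ‖(K ^ n) q k‖ ≤ (n.factorial : ℝ)⁻¹ * m ^ n :=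
            mul_le_mul_of_nonneg_left hKn (inv_nonneg.2 hnpos.le)
        _ ≤ ((d.factorial : ℝ) * ((n - d).factorial : ℝ))⁻¹ * m ^ n := by
            apply mul_le_mul_of_nonneg_right _ (pow_nonneg hm0 n)
            exact inv_anti₀ (mul_pos hdpos hndpos) hfac
        _ = c * (m ^ (n - d) / (n - d).factorial) := by
            rw [hc, ← pow_sub_mul_pow m hn]
            field_simp
    · rw [if_neg hn, pow_apply_eq_zero_of_lt K D hD0 hDt hK n q k (lt_of_lt_of_le (not_le.1 hn) hd), norm_zero, mul_zero]
  have h := hf.norm_le_of_bounded hgsum hle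
  rw [hc] at h
  exact h

end Generic

/-! ## §2 The free torus one-body matrix `h₀ = hubbardOneBody (fermionTorusGraph 2 L) 1 0` -/

section Torus

variable (L : ℕ) [NeZero L]

omit [NeZero L] in
/-- The entries of the free torus one-body matrix: `(h₀)_{(x,σ),(y,τ)} = -[x ∼ y][σ = τ]`. -/
theorem hubbardOneBody_torus_apply (q k : Orb (FermionTorus 2 L)) :
    hubbardOneBody (fermionTorusGraph 2 L) 1 0 q k =
      if (fermionTorusGraph 2 L).Adj (ofLex q).1 (ofLex k).1 ∧ (ofLex q).2 = (ofLex k).2 then -1 else 0 := by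
  rw [hubbardOneBody_apply, Complex.ofReal_one, Complex.ofReal_zero]
  simp only [ite_self, sub_zero]

omit [NeZero L] in
/-- The norm of an entry of `h₀` is the indicator of "nearest neighbours, same spin". -/
theorem norm_hubbardOneBody_torus_apply (q k : Orb (FermionTorus 2 L)) :
    ‖hubbardOneBody (fermionTorusGraph 2 L) 1 0 q k‖ =
      if (fermionTorusGraph 2 L).Adj (ofLex q).1 (ofLex k).1 ∧ (ofLex q).2 = (ofLex k).2 then 1 else 0 := by
  rw [hubbardOneBody_torus_apply]
  split_ifs <;> simp

omit [NeZero L] in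
/-- The norm of the entry of `h₀` at a target orbital `(y, τ)`. -/
theorem norm_hubbardOneBody_torus_orb (q : Orb (FermionTorus 2 L)) (y : FermionTorus 2 L) (τ : Fin 2) :
    ‖hubbardOneBody (fermionTorusGraph 2 L) 1 0 q (orb y τ)‖ =
      if (fermionTorusGraph 2 L).Adj (ofLex q).1 y ∧ (ofLex q).2 = τ then 1 else 0 := by
  rw [norm_hubbardOneBody_torus_apply]
  rfl

/-- **Row sums of `h₀`**: `Σ_k ‖(h₀)_{qk}‖ ≤ 4` (each torus site has at most four neighbours). -/
theorem sum_norm_hubbardOneBody_torus_le (q : Orb (FermionTorus 2 L)) :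
    ∑ k, ‖hubbardOneBody (fermionTorusGraph 2 L) 1 0 q k‖ ≤ 4 := by
  rw [sum_orb_eq_sum_sum]
  have h : ∀ y : FermionTorus 2 L, (∑ τ : Fin 2, ‖hubbardOneBody (fermionTorusGraph 2 L) 1 0 q (orb y τ)‖) =
      if (fermionTorusGraph 2 L).Adj (ofLex q).1 y then 1 else 0 := by
    intro y
    simp only [norm_hubbardOneBody_torus_orb]
    by_cases hy : (fermionTorusGraph 2 L).Adj (ofLex q).1 y
    · simp only [hy, true_and, if_true]
      rw [Finset.sum_ite_eq]
      simp
    · simp only [hy, false_and, if_false, Finset.sum_const_zero]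
  simp only [h]
  rw [Finset.sum_boole]
  have hc := card_filter_fermionTorusGraph_adj_le (d := 2) (L := L) (ofLex q).1
  exact_mod_cast hc

/-- **Column sums of `h₀`** (`h₀` is symmetric): `Σ_k ‖(h₀)_{kq}‖ ≤ 4`. -/
theorem sum_norm_hubbardOneBody_torus_le' (q : Orb (FermionTorus 2 L)) :
    ∑ k, ‖hubbardOneBody (fermionTorusGraph 2 L) 1 0 k q‖ ≤ 4 := by
  have h : ∀ k, ‖hubbardOneBody (fermionTorusGraph 2 L) 1 0 k q‖ = ‖hubbardOneBody (fermionTorusGraph 2 L) 1 0 q k‖ := by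
    intro k
    rw [norm_hubbardOneBody_torus_apply, norm_hubbardOneBody_torus_apply]
    simp only [(fermionTorusGraph 2 L).adj_comm, eq_comm]
  simp only [h]
  exact sum_norm_hubbardOneBody_torus_le L q

omit [NeZero L] in
/-- `h₀` is a symmetric matrix. -/
theorem hubbardOneBody_torus_transpose :
    (hubbardOneBody (fermionTorusGraph 2 L) 1 0)ᵀ = hubbardOneBody (fermionTorusGraph 2 L) 1 0 := by
  ext q k
  rw [transpose_apply, hubbardOneBody_torus_apply, hubbardOneBody_torus_apply]
  simp only [(fermionTorusGraph 2 L).adj_comm, eq_comm]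

/-- A non-zero entry of `h₀` joins torus-neighbours: `dist_∞ ≤ 1`. -/
theorem torusDist_le_one_of_hubbardOneBody_ne_zero {q k : Orb (FermionTorus 2 L)}
    (h : hubbardOneBody (fermionTorusGraph 2 L) 1 0 q k ≠ 0) :
    torusDist (ofLex q).1.toTorusSite (ofLex k).1.toTorusSite ≤ 1 := by
  rw [hubbardOneBody_torus_apply] at h
  by_cases hadj : (fermionTorusGraph 2 L).Adj (ofLex q).1 (ofLex k).1 ∧ (ofLex q).2 = (ofLex k).2
  · exact torusDist_le_one_of_adj ((fermionTorusGraph_adj _ _).1 hadj.1)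
  · rw [if_neg hadj] at h; exact absurd rfl h

/-- **Decay of the one-body propagator on the free torus**: for every `c : ℂ`, all orbitals `(x,σ), (y,τ)` and every
`d ≤ dist_∞(x,y)`, `‖(e^{c h₀})_{(x,σ),(y,τ)}‖ ≤ (4‖c‖)^d/d! · e^{4‖c‖}`. -/
theorem norm_exp_smul_hubbardOneBody_apply_le (c : ℂ) (q k : Orb (FermionTorus 2 L)) {d : ℕ}
    (hd : d ≤ torusDist (ofLex q).1.toTorusSite (ofLex k).1.toTorusSite) :
    ‖(exp (c • hubbardOneBody (fermionTorusGraph 2 L) 1 0)) q k‖ ≤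
      (4 * ‖c‖) ^ d / d.factorial * Real.exp (4 * ‖c‖) := by
  refine norm_exp_apply_le (c • hubbardOneBody (fermionTorusGraph 2 L) 1 0)
    (fun q k : Orb (FermionTorus 2 L) => torusDist (ofLex q).1.toTorusSite (ofLex k).1.toTorusSite)
    (fun q => torusDist_self _) (fun q l k => torusDist_triangle' _ _ _) ?_ (by positivity) ?_ q k hd
  · intro l k hlk
    rw [Matrix.smul_apply, smul_eq_mul] at hlk
    exact torusDist_le_one_of_hubbardOneBody_ne_zero L (right_ne_zero_of_mul hlk)
  · intro q
    simp only [Matrix.smul_apply, smul_eq_mul, norm_mul, ← Finset.mul_sum]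
    calc ‖c‖ * ∑ k, ‖hubbardOneBody (fermionTorusGraph 2 L) 1 0 q k‖ ≤ ‖c‖ * 4 :=
          mul_le_mul_of_nonneg_left (sum_norm_hubbardOneBody_torus_le L q) (norm_nonneg c)
      _ = 4 * ‖c‖ := mul_comm _ _

omit [NeZero L] in
/-- `e^{c h₀}` is a symmetric matrix. -/
theorem exp_smul_hubbardOneBody_apply_comm (c : ℂ) (q k : Orb (FermionTorus 2 L)) :
    (exp (c • hubbardOneBody (fermionTorusGraph 2 L) 1 0)) q k = (exp (c • hubbardOneBody (fermionTorusGraph 2 L) 1 0)) k q := by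
  have h : (c • hubbardOneBody (fermionTorusGraph 2 L) 1 0)ᵀ = c • hubbardOneBody (fermionTorusGraph 2 L) 1 0 := by
    rw [transpose_smul, hubbardOneBody_torus_transpose]
  have he := Matrix.exp_transpose (c • hubbardOneBody (fermionTorusGraph 2 L) 1 0)
  rw [h] at he
  have := congrFun (congrFun he k) q
  rw [transpose_apply] at this
  exact this.symm

omit [NeZero L] in
/-- `e^{c h₀}` is spin-block-diagonal: its entries between orbitals of different spin vanish (`h₀` commutes with the spin label). -/
theorem exp_smul_hubbardOneBody_apply_of_spin_ne (c : ℂ) {q k : Orb (FermionTorus 2 L)} (hqk : (ofLex q).2 ≠ (ofLex k).2) :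
    (exp (c • hubbardOneBody (fermionTorusGraph 2 L) 1 0)) q k = 0 := by
  set S : Matrix (Orb (FermionTorus 2 L)) (Orb (FermionTorus 2 L)) ℂ := diagonal fun o => (((ofLex o).2 : ℕ) : ℂ) with hS
  have hcomm : Commute S (c • hubbardOneBody (fermionTorusGraph 2 L) 1 0) := by
    refine Commute.smul_right ?_ c
    change S * hubbardOneBody (fermionTorusGraph 2 L) 1 0 = hubbardOneBody (fermionTorusGraph 2 L) 1 0 * S
    ext o o'
    rw [hS, diagonal_mul, mul_diagonal, hubbardOneBody_torus_apply]
    by_cases h : (fermionTorusGraph 2 L).Adj (ofLex o).1 (ofLex o').1 ∧ (ofLex o).2 = (ofLex o').2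
    · rw [if_pos h, h.2, mul_comm]
    · rw [if_neg h, mul_zero, zero_mul]
  have hE := (hcomm.exp_right).eq
  have h := congrFun (congrFun hE q) k
  rw [hS, diagonal_mul, mul_diagonal] at h
  have hne : ((((ofLex q).2 : ℕ) : ℂ)) ≠ (((ofLex k).2 : ℕ) : ℂ) := by
    intro h'
    exact hqk (Fin.ext (by exact_mod_cast h'))
  have h' : ((((ofLex q).2 : ℕ) : ℂ) - (((ofLex k).2 : ℕ) : ℂ)) * (exp (c • hubbardOneBody (fermionTorusGraph 2 L) 1 0)) q k = 0 := by
    rw [sub_mul, h, mul_comm, sub_self]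
  exact (mul_eq_zero.1 h').resolve_left (sub_ne_zero.2 hne)

/-- **The commutator bound of the free torus Hamiltonian**: `‖[dΓ(h₀), c†_{xσ}]‖ ≤ 4` (the rate consumed by the tree's sector
transfer lemma `partitionFn_spinSector_transfer_up/_down`). -/
theorem norm_commutator_dGamma_hubbardOneBody_creation_le (o : Orb (FermionTorus 2 L)) :
    ‖dGamma (hubbardOneBody (fermionTorusGraph 2 L) 1 0) * creation o -
        creation o * dGamma (hubbardOneBody (fermionTorusGraph 2 L) 1 0)‖ ≤ 4 := by
  rw [dGamma_commutator_creation]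
  calc ‖∑ k, hubbardOneBody (fermionTorusGraph 2 L) 1 0 k o • (creation k : Matrix _ _ ℂ)‖
      ≤ ∑ k, ‖hubbardOneBody (fermionTorusGraph 2 L) 1 0 k o • (creation k : Matrix _ _ ℂ)‖ := norm_sum_le _ _
    _ ≤ ∑ k, ‖hubbardOneBody (fermionTorusGraph 2 L) 1 0 k o‖ := Finset.sum_le_sum fun k _ => by
        rw [norm_smul]
        exact (mul_le_mul_of_nonneg_left (norm_creation_le_one k) (norm_nonneg _)).trans (le_of_eq (mul_one _))
    _ ≤ 4 := sum_norm_hubbardOneBody_torus_le' L o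

/-- **The flux-free `t–U` torus at `U = t' = 0` is the quadratic Hamiltonian `dΓ(h₀)`.** -/
theorem hubbardTorusTT'Flux_free_eq_dGamma :
    hubbardTorusTT'Flux L 0 0 0 = dGamma (hubbardOneBody (fermionTorusGraph 2 L) 1 0) := by
  rw [hubbardTorusTT'Flux_zero, hubbardTorusTT'_zero, hubbardTorus, ← hamiltonianWith_zero, hamiltonianWith_zero_eq_dGamma]

omit [NeZero L] in
/-- `|FermionTorus 2 L| = L²`. -/
theorem card_fermionTorus_two : Fintype.card (FermionTorus 2 L) = L ^ 2 := by
  rw [Fintype.card_lex, Fintype.card_fun, Fintype.card_fin, Fintype.card_fin]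

end Torus

end Summit.Ventures.CertifiedManyBodySolver.Theorems.TcThermcert1.FreeGasCurrentClustering

end
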